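import Mathlib
import HarnessLib

/-!
# Barrier (AnomalousDissipation): quiet steady roots cap every ν-uniform dissipation floor of a fixed
Galerkin truncation (QuietRootFloorBarrier)
(D-0021 barrier catalogue for `Summits/AnomalousDissipation`; summit statement
`AnomalousDissipation := Literature.Turb.ZerothLaw`)

Provenance: cell `ad-ideate`, seat p3 (planner-ad-ideate-p3-g3-0), 2026-08-25, typed AND PROVED sketch
`run/shared/lean/pub/ad-ideate/ad-ideate-p3/barrier/QuietRootFloorBarrier.lean` (v2, sha256 bbb7dd5f…, farm rc 0,
0 sorries, axioms `propext`/`Classical.choice`/`Quot.sound`), barrier block `QuietRootFloorBarrier.md`; referee harvest GO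
`ad-ideate-ref/REVIEW-ad-p3-BARRIER-V2.md` ("the NONSINGULAR-linearisation hypothesis is the load-bearing scope line");
landed by the cell's literature seat verbatim up to: namespace `Literature.Barriers.AnomalousDissipation.QuietRootFloor`
(was `AdIdeate.P3`), explicit `(S : GalerkinSystem ι)` binders on the `Prop`-valued notions, `QuietRootFloorBarrier_holds`
(was `quietRootFloorBarrier_holds`), helper lemmas private, cite tags.

## The objects (the cell's PREREG §1, rational gauge)

A finite Galerkin truncation of forced Navier–Stokes in the gauge `ν = r·(2π)^(-3/2)`, `τ = (2π)^(3/2) t`: real mode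
amplitudes `x : ι → ℝ` on a finite mode set `ι`, `dx_m/dτ = f_m − r K_m x_m − B(x,x)_m` with `K_m = |k_m|²`, `B` bilinear
(Leray-projected convection restricted to the truncation) and ENERGY-CONSERVING for the weights `w` (`∑ w_m x_m B(x,x)_m = 0`).
Mean dissipation of an invariant measure `μ` is `r·∫Ĝ dμ` up to the fixed gauge factor, `Ĝ(x) = ∑ K_m w_m x_m²`; a steady state
is the Dirac invariant measure at a zero of the field, so every «floor» valid for all invariant measures is in particular valid at
every steady state — which is all the barrier uses.  Printed form of the mechanism: "Suppose that there is an unstable steady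
solution a₀, f(a₀) = 0 … the existence of such an unstable solution does affect the bound" (Chernyshenko–Goulart–Huang–
Papachristodoulou 2014, §3b, p. 14); sharpness of auxiliary-function bounds over invariant measures (Tobasco–Goluskin–Doering
2018, Thm. 1) is why an SOS floor cannot beat the quiet branch.

## What is vendored (all PROVED; one named fact `QuietRootFloorBarrier` with `QuietRootFloorBarrier_holds` in this file)

* `QuietRootFloor.GalerkinSystem` and its `field`, `G`, `IsSteady`, `linB`; the hypothesis `HasNondegenerateRoot`
  (a root of the truncated steady Euler system `B(v,v) = f` with nonsingular linearisation), the conclusion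
  `SteadyBranchLinearDissipation` (`∃ C r₀ > 0, ∀ r ∈ (0,r₀), ∃` steady `x(r)`, `r·Ĝ(x(r)) ≤ C·r`), the target shape it kills
  `UniformFloor` (`∃ ε r₀ > 0, ∀ r ∈ (0,r₀), ∀` steady `x`, `ε ≤ r·Ĝ(x)`).
* `QuietRootFloorBarrier : Prop` (`HasNondegenerateRoot → SteadyBranchLinearDissipation` for every finite truncation) and its
  PROOF `QuietRootFloorBarrier_holds` (inverse function theorem at `r = 0` for `Ψ(r,x) = (r, B(x,x) + rKx)`, Mathlib
  `HasStrictFDerivAt.localInverse`); the pure-logic use `floor_le_linear_of_branch`, `not_uniformFloor_of_branch`,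
  `not_uniformFloor_of_root`, and the unconditional `GalerkinSystem.not_uniformFloor_of_nondegenerateRoot :
  S.HasNondegenerateRoot → ¬ S.UniformFloor`.

BARRIER (D-0021):
- technique_class: auxiliary-functional / moment-SOS (Lyapunov-type) lower bounds on long-time averages over ALL invariant measures of a FIXED finite-dimensional Galerkin truncation of forced Navier–Stokes, uniform in the viscosity [cite: ChernyshenkoEtAl2014, §3 (bounds for ẋ = f(x) by polynomial V, §3b)] [cite: TobascoGoluskinDoering2018, Thm. 1 (sharpness over invariant measures)] [cite: Goluskin2017, §2 (SDP bounds on mean moments)]; certified computation (interval Newton/Krawczyk, exact SDP rounding). The Lean class: `QuietRootFloor.GalerkinSystem ι` (finite `ι`, `K, w > 0`, energy-conserving bilinear `B`) and floors of the shape `UniformFloor`.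
- blocks: every «certified dissipation floor uniform in ν» programme of the shape `UniformFloor` — `∃ ε > 0 ∃ r₀ > 0 ∀ r ∈ (0, r₀) ∀` steady states `x` of the truncation at damping `r`: `r·Ĝ(x) ≥ ε` (and therefore every floor valid for all invariant measures, all time averages, or the global attractor of the truncation, which contain the steady states [cite: TobascoGoluskinDoering2018, Thm. 1] [cite: Goluskin2018, §2 (bounds over the global attractor)]) — in any truncation whose steady truncated-Euler system `B(v,v) = f` has a root with nonsingular linearisation (`GalerkinSystem.not_uniformFloor_of_nondegenerateRoot`). This is the cell's parked Tier 1 (README seat p3: «certified lower bound on the dissipation rate, uniform in ν over a range, for a Galerkin-truncated Kolmogorov/Taylor–Green flow via SOS») in its `ν → 0` form; it does NOT block window statements at fixed `ν` nor conditional floors over measures constrained away from the quiet states (Goluskin's non-global framework [cite: Goluskin2018, §3.3]).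
- because: `Φ(r, x) = f − rKx − B(x, x)` has `Φ(0, v) = 0` and `∂ₓΦ(0, v) = −linB(v)` invertible, so the inverse function theorem gives a branch `r ↦ x(r)` of steady states on `[0, r₀)` with `x(0) = v`; `Ĝ` is continuous, so `r·Ĝ(x(r)) ≤ (Ĝ(v) + 1)·r`: the dissipation of a genuine invariant measure (the Dirac mass at `x(r)`) is `O(r) = O(ν)` (`QuietRootFloorBarrier_holds`, this file); such a branch contradicts `UniformFloor` (take `r = min(r₀, r₁, ε/(|C|+1))/2`; `not_uniformFloor_of_branch`). The printed qualitative form: «Suppose that there is an unstable steady solution a₀, f(a₀) = 0 … the existence of such an unstable solution does affect the bound» [cite: ChernyshenkoEtAl2014, §3b p. 14]; sharpness of SOS/auxiliary-function bounds over invariant measures [cite: TobascoGoluskinDoering2018, Thm. 1]. New relative to print (the cell's): the `ν → 0` QUANTITATIVE form for NS-type truncations (roots of truncated steady Euler ⇒ floors `O(ν)` with the explicit constant `Ĝ(v)`) and CERTIFIED instances of `SteadyBranchLinearDissipation` with explicit `(C, r₀)` for the Taylor–Green truncations `T_20`, `T_27`, `T_36` of the cell's PREREG §4g (exact-rational `r`-interval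 Krawczyk certificates, kit jobs j243500/j243718; `F_min,20(ν) ≤ 117.31·ν` on `(0, 1.289e-4]`, `F_min,27 ≤ 115.57·ν` on `(0, 5.477e-5]`, `F_min,36 ≤ 134.81·ν` on `(0, 1.993e-6]`; referee-verified, `ad-ideate-ref/REVIEW-ad-p3-ERRATA.md`) — cell artefacts, not printed sources.
- evasions_known: (a) restrict the class of measures: noise-regularised stationary densities [cite: ChernyshenkoEtAl2014, §3b(ii) («yet to be applied to a system of practical interest»)] or the non-global S-procedure over a forward-invariant semialgebraic set excluding the quiet states [cite: Goluskin2018, §3.3]; (b) fixed-`ν` WINDOW floors — not uniform in `ν`, not blocked; (c) let the truncation grow with `ν` (`N = N(ν) ≥ k_η`): then `ι` is not fixed and the lemma does not apply (no SOS certificate uniform in `N` is in print either); (d) floors on OTHER functionals than `r·Ĝ` are not covered; (e) extremal unstable periodic orbits rather than steady states as the pinning objects are the nearest printed computation (nine-mode shear model) [cite: LakshmiEtAl2019, pp. 13–14] — same mechanism, not an evasion.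
- scope_caveats: (i) NONSINGULAR linearisation is essential and NOT generic in symmetric truncations: the cell's `T_12`, `T_19` have ONLY degenerate roots (rank-deficient `linB`) and ESCAPE the lemma (for `T_12` a steady branch exists but is certified only on `[1.061e-8, 2.657e-4]`, not down to `r = 0`; for `T_19` no steady state was found near its roots); (ii) the statement is per truncation (fixed finite `ι`): `C = C_R` grows and `r₀ = r₀(R)` shrinks with the truncation, so NOTHING follows about Navier–Stokes or about the summit `Literature.Turb.ZerothLaw` (existential, about loud solutions at bounded energy — not a floor over all invariant measures); (iii) energy conservation of `B` is not used by the lemma itself (only by the dictionary «dissipation = work = r·Ĝ» at steady states); (iv) the branch states are typically UNSTABLE — invisible to time integration but invariant measures, which is the point [cite: ChernyshenkoEtAl2014, §3b p. 14]; (v) `G`, `IsSteady`, `UniformFloor` are this file's renderings in the rational gauge; the physical dissipation differs by the fixed gauge factor.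
- status: established — PROVED in this file (`QuietRootFloorBarrier_holds`, `GalerkinSystem.not_uniformFloor_of_nondegenerateRoot`; Mathlib only); mechanism printed [cite: ChernyshenkoEtAl2014, §3b]; cell referee audit `REVIEW-ad-p3-BARRIER-V2.md` (PASS).

## References

* S. I. Chernyshenko, P. Goulart, D. Huang, A. Papachristodoulou, *Polynomial sum of squares in fluid dynamics: a review with
  a look ahead*, Phil. Trans. R. Soc. A 372 (2014) 20130350, §3, §3b p. 14 (held: `paper:doi-10-1098-rsta-2013-0350`). [`ChernyshenkoEtAl2014`]
* I. Tobasco, D. Goluskin, C. R. Doering, Phys. Lett. A 382 (2018) 382–386, Thm. 1 (held: `paper:arxiv-1705.07096`). [`TobascoGoluskinDoering2018`]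
* D. Goluskin, *Bounding extrema over global attractors using polynomial optimisation*, Nonlinearity 33 (2020) 4878 (arXiv:1807.09814), §2, §3.3. [`Goluskin2018`]
* D. Goluskin, J. Nonlinear Sci. 28 (2018) (Lorenz mean moments by SDP), §2. [`Goluskin2017`]
* M. Lakshmi, G. Fantuzzi, J. Fernández-Caballero, Y. Hwang, S. Chernyshenko, SIAM J. Appl. Dyn. Syst. 19 (2020) 763–787
  (arXiv:1906.04001), pp. 13–14. [`LakshmiEtAl2019`]
-/

noncomputable section

namespace Literature.Barriers.AnomalousDissipation

namespace QuietRootFloor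

open scoped BigOperators
open Filter Topology

/-- A finite Galerkin system of Navier–Stokes type: amplitudes `x : ι → ℝ`, forcing `f`, damping weights `K_m = |k_m|² > 0`,
energy weights `w_m > 0`, an energy-conserving bilinear term `B` (`dx_m/dτ = f_m − r K_m x_m − B(x,x)_m`; rational gauge of the
cell's PREREG §1) — the finite-dimensional systems `ẋ = f(x)` with energy-conserving quadratic term obtained by Galerkin
truncation of the Navier–Stokes equations, to which the sum-of-squares bounds apply.
[cite: ChernyshenkoEtAl2014, §3 (finite-dimensional truncations; uncertainty in `f` from energy-conserving nonlinearity)] -/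
structure GalerkinSystem (ι : Type) [Fintype ι] where
  /-- forcing coefficients `f_m` (supported inside the truncation) -/
  f : ι → ℝ
  /-- damping weights `K_m = |k_m|² > 0` -/
  K : ι → ℝ
  /-- energy weights `w_m > 0` (`E = ½ ∑ w_m x_m²`) -/
  w : ι → ℝ
  /-- the truncated quadratic term, as a bilinear map -/
  B : (ι → ℝ) →ₗ[ℝ] (ι → ℝ) →ₗ[ℝ] (ι → ℝ)
  K_pos : ∀ m, 0 < K m
  w_pos : ∀ m, 0 < w m
  /-- energy conservation of the quadratic term -/
  energy_conserving : ∀ x : ι → ℝ, ∑ m, w m * x m * B x x m = 0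

namespace GalerkinSystem

variable {ι : Type} [Fintype ι] (S : GalerkinSystem ι)

/-- The vector field at damping parameter `r` (= rescaled viscosity). [folklore] -/
def field (r : ℝ) (x : ι → ℝ) : ι → ℝ := fun m => S.f m - r * S.K m * x m - S.B x x m

/-- `Ĝ(x) = ∑ K_m w_m x_m²`; the dissipation rate of the state `x` at parameter `r` is `r·Ĝ(x)`. [folklore] -/
def G (x : ι → ℝ) : ℝ := ∑ m, S.K m * S.w m * x m ^ 2

/-- `x` is a steady state at parameter `r` (a zero of the truncated vector field, "`f(a₀) = 0`").
[cite: ChernyshenkoEtAl2014, §3b (p. 14: an unstable steady solution caps every bound over all invariant measures)] -/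
def IsSteady (S : GalerkinSystem ι) (r : ℝ) (x : ι → ℝ) : Prop := S.field r x = 0

/-- The linearisation `h ↦ B(v,h) + B(h,v)` of `x ↦ B(x,x)` at `v`. [folklore] -/
def linB (v : ι → ℝ) : (ι → ℝ) →ₗ[ℝ] (ι → ℝ) := S.B v + S.B.flip v

/-- HYPOTHESIS of the barrier: the truncated steady Euler system `B(v,v) = f` has a root with
NONSINGULAR linearisation (a «nondegenerate root»; `r = 0` limit of a steady branch). The
certified sites: T_20 (n = 25), T_27 (n = 39), T_36 (n = 60) of the Taylor–Green truncations
(PREREG §4d/§4f); T_12 and T_19 have only DEGENERATE roots and escape the hypothesis.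
[cite: ChernyshenkoEtAl2014, §3b (p. 14: an unstable steady solution caps every bound over all invariant measures)] -/
def HasNondegenerateRoot (S : GalerkinSystem ι) : Prop :=
  ∃ v : ι → ℝ, S.B v v = S.f ∧ Function.Bijective (S.linB v)

/-- CONCLUSION of the barrier: a branch of steady states whose dissipation is `O(r)`:
`∃ C r₀ > 0, ∀ r ∈ (0,r₀), ∃` steady `x(r)` with `r·Ĝ(x(r)) ≤ C·r`. The certified anti-floors
A_R (PREREG §4g) are exactly instances of this `Prop` with explicit `(C, r₀)`:
`(117.31·κ, 136255/2²⁶)` for T_20, `(115.57·κ, 231569/2²⁸)` for T_27, `(134.81·κ, 4213/2²⁷)`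
for T_36, `κ` the fixed gauge factor between `r·Ĝ` and the physical dissipation.
[cite: ChernyshenkoEtAl2014, §3b (p. 14: an unstable steady solution caps every bound over all invariant measures)] -/
def SteadyBranchLinearDissipation (S : GalerkinSystem ι) : Prop :=
  ∃ C r₀ : ℝ, 0 < r₀ ∧ ∀ r ∈ Set.Ioo (0 : ℝ) r₀, ∃ x : ι → ℝ, S.IsSteady r x ∧ r * S.G x ≤ C * r

/-- The Tier-1 target shape that the barrier kills: a POSITIVE floor on the dissipation rate,
UNIFORM in the viscosity parameter on some interval `(0, r₀)`, valid at every steady state (and a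
fortiori one valid for every invariant measure / every time average of every trajectory) — the shape of the
auxiliary-function / sum-of-squares lower bounds over all invariant measures. [cite: TobascoGoluskinDoering2018, Thm. 1]
[cite: ChernyshenkoEtAl2014, §3b (p. 14: an unstable steady solution caps every bound over all invariant measures)] -/
def UniformFloor (S : GalerkinSystem ι) : Prop :=
  ∃ ε r₀ : ℝ, 0 < ε ∧ 0 < r₀ ∧ ∀ r ∈ Set.Ioo (0 : ℝ) r₀, ∀ x : ι → ℝ, S.IsSteady r x → ε ≤ r * S.G x

end GalerkinSystem

/-- **QuietRootFloorBarrier** (the analytic lemma; implicit function theorem at `r = 0` applied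
to `Φ(r,x) = f − r K x − B(x,x)`, `Φ(0,v) = 0`, `∂ₓΦ(0,v) = −linB v` invertible; then
`x(r) → v`, `Ĝ(x(r)) → Ĝ(v)` and `C = Ĝ(v) + 1` works on a small `(0,r₀)`). PROVED below:
`QuietRootFloorBarrier_holds`. BARRIER block: module docstring.
[cite: ChernyshenkoEtAl2014, §3b (p. 14: an unstable steady solution caps every bound over all invariant measures)] -/
def QuietRootFloorBarrier : Prop :=
  ∀ (ι : Type) [Fintype ι] (S : GalerkinSystem ι),
    S.HasNondegenerateRoot → S.SteadyBranchLinearDissipation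

namespace GalerkinSystem

variable {ι : Type} [Fintype ι] (S : GalerkinSystem ι)

/-- How the barrier is used (pure logic): along the branch, every floor valid at all steady
states is at most `C·r` — pointwise in `r`. [cite: ChernyshenkoEtAl2014, §3b (p. 14: an unstable steady solution caps every bound over all invariant measures)] -/
theorem floor_le_linear_of_branch (h : S.SteadyBranchLinearDissipation) :
    ∃ C r₀ : ℝ, 0 < r₀ ∧ ∀ r ∈ Set.Ioo (0 : ℝ) r₀, ∀ L : ℝ,
      (∀ x : ι → ℝ, S.IsSteady r x → L ≤ r * S.G x) → L ≤ C * r := by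
  obtain ⟨C, r₀, hr₀, hbr⟩ := h
  refine ⟨C, r₀, hr₀, fun r hr L hL => ?_⟩
  obtain ⟨x, hx, hle⟩ := hbr r hr
  exact (hL x hx).trans hle

/-- Hence NO ν-uniform positive floor exists in a truncation with a nondegenerate root
(the certified form of the Tier-1 park reason, PREREG §0 / rule D-ι). [cite: ChernyshenkoEtAl2014, §3b (p. 14: an unstable steady solution caps every bound over all invariant measures)] -/
theorem not_uniformFloor_of_branch (h : S.SteadyBranchLinearDissipation) : ¬ S.UniformFloor := by
  rintro ⟨ε, r₁, hε, hr₁, hfloor⟩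
  obtain ⟨C, r₀, hr₀, hbr⟩ := h
  have hA : 0 < |C| + 1 := by positivity
  have hq : 0 < ε / (|C| + 1) := div_pos hε hA
  have hm : 0 < min (min r₀ r₁) (ε / (|C| + 1)) := lt_min (lt_min hr₀ hr₁) hq
  set q := min (min r₀ r₁) (ε / (|C| + 1)) with hq_def
  have hq₀ : q ≤ r₀ := (min_le_left _ _).trans (min_le_left _ _)
  have hq₁ : q ≤ r₁ := (min_le_left _ _).trans (min_le_right _ _)
  have hqε : q ≤ ε / (|C| + 1) := min_le_right _ _
  set r := q / 2 with hr_def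
  have hr : 0 < r := by positivity
  have hrr₀ : r < r₀ := by linarith
  have hrr₁ : r < r₁ := by linarith
  have hrε : r * (|C| + 1) < ε := by
    have h1 : r * (|C| + 1) ≤ (ε / (|C| + 1)) / 2 * (|C| + 1) := by
      have : r ≤ (ε / (|C| + 1)) / 2 := by linarith
      exact mul_le_mul_of_nonneg_right this hA.le
    have h2 : (ε / (|C| + 1)) / 2 * (|C| + 1) = ε / 2 := by
      field_simp
    linarith
  obtain ⟨x, hx, hle⟩ := hbr r ⟨hr, hrr₀⟩
  have h1 : ε ≤ r * S.G x := hfloor r ⟨hr, hrr₁⟩ x hx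
  have h2 : C * r ≤ |C| * r := mul_le_mul_of_nonneg_right (le_abs_self C) hr.le
  have h3 : r * (|C| + 1) = |C| * r + r := by ring
  linarith

/-- The barrier in one line: under `QuietRootFloorBarrier`, a nondegenerate root forbids any
ν-uniform positive dissipation floor over the steady states of the truncation. [cite: ChernyshenkoEtAl2014, §3b (p. 14: an unstable steady solution caps every bound over all invariant measures)] -/
theorem not_uniformFloor_of_root (hB : QuietRootFloorBarrier) (h : S.HasNondegenerateRoot) :
    ¬ S.UniformFloor :=
  S.not_uniformFloor_of_branch (hB ι S h)

end GalerkinSystem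

/-! ## Proof of `QuietRootFloorBarrier` (inverse function theorem)

We apply Mathlib's local inverse (`HasStrictFDerivAt.localInverse`) to
`Ψ(r,x) = (r, B(x,x) + r·Kx)` at `(0,v)`: its derivative `(dr,dx) ↦ (dr, linB v dx + dr·Kv)` is a
bijection of the finite-dimensional space `ℝ × (ι → ℝ)`, `Ψ(0,v) = (0,f)`, so for `r` near `0`
the point `g(r,f) = (r, x(r))` solves `B(x,x) + r K x = f`, i.e. `x(r)` is steady at `r`, and
`x(r) → v` gives `Ĝ(x(r)) < Ĝ(v) + 1`.
-/

namespace GalerkinSystem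

variable {ι : Type} [Fintype ι] (S : GalerkinSystem ι)

/-- `x ↦ (K_m x_m)_m` as a continuous linear map. [folklore] -/
def Kop : (ι → ℝ) →L[ℝ] (ι → ℝ) :=
  ContinuousLinearMap.pi fun m => S.K m • ContinuousLinearMap.proj m

/-- Unfolding `Kop`. [folklore] -/
@[simp] private theorem Kop_apply (x : ι → ℝ) (m : ι) : S.Kop x m = S.K m * x m := by
  simp [Kop]

/-- The quadratic term as a continuous bilinear map (automatic in finite dimension). [folklore] -/
def Bc : (ι → ℝ) →L[ℝ] (ι → ℝ) →L[ℝ] (ι → ℝ) :=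
  LinearMap.toContinuousLinearMap
    ((LinearMap.toContinuousLinearMap :
        ((ι → ℝ) →ₗ[ℝ] (ι → ℝ)) ≃ₗ[ℝ] ((ι → ℝ) →L[ℝ] (ι → ℝ))).toLinearMap ∘ₗ S.B)

/-- Unfolding `Bc`. [folklore] -/
@[simp] private theorem Bc_apply (x y : ι → ℝ) : S.Bc x y = S.B x y := by
  simp [Bc]

/-- `Ψ(r,x) = (r, B(x,x) + r·Kx)`. [folklore] -/
def Psi (p : ℝ × (ι → ℝ)) : ℝ × (ι → ℝ) := (p.1, S.Bc p.2 p.2 + p.1 • S.Kop p.2)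

/-- The derivative of `Psi` at `(0,v)`. [folklore] -/
def PsiDeriv (v : ι → ℝ) : (ℝ × (ι → ℝ)) →L[ℝ] (ℝ × (ι → ℝ)) :=
  (ContinuousLinearMap.fst ℝ ℝ (ι → ℝ)).prod
    (((S.Bc.isBoundedBilinearMap.deriv (v, v)).comp
        ((ContinuousLinearMap.snd ℝ ℝ (ι → ℝ)).prod (ContinuousLinearMap.snd ℝ ℝ (ι → ℝ))))
      + ((0 : ℝ) • S.Kop.comp (ContinuousLinearMap.snd ℝ ℝ (ι → ℝ))
          + (ContinuousLinearMap.fst ℝ ℝ (ι → ℝ)).smulRight (S.Kop v)))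

/-- Unfolding `PsiDeriv`. [folklore] -/
private theorem PsiDeriv_apply (v : ι → ℝ) (q : ℝ × (ι → ℝ)) :
    S.PsiDeriv v q = (q.1, S.B v q.2 + S.B q.2 v + q.1 • S.Kop v) := by
  simp [PsiDeriv, IsBoundedBilinearMap.deriv_apply]

/-- `Ψ` is strictly differentiable at `(0,v)` with derivative `PsiDeriv v`. [folklore] -/
private theorem hasStrictFDerivAt_Psi (v : ι → ℝ) :
    HasStrictFDerivAt S.Psi (S.PsiDeriv v) ((0 : ℝ), v) := by
  have h1 : HasStrictFDerivAt (fun p : ℝ × (ι → ℝ) => p.1)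
      (ContinuousLinearMap.fst ℝ ℝ (ι → ℝ)) ((0 : ℝ), v) := hasStrictFDerivAt_fst
  have h2 : HasStrictFDerivAt (fun p : ℝ × (ι → ℝ) => p.2)
      (ContinuousLinearMap.snd ℝ ℝ (ι → ℝ)) ((0 : ℝ), v) := hasStrictFDerivAt_snd
  have hb : HasStrictFDerivAt (fun p : ℝ × (ι → ℝ) => S.Bc p.2 p.2)
      ((S.Bc.isBoundedBilinearMap.deriv (v, v)).comp
        ((ContinuousLinearMap.snd ℝ ℝ (ι → ℝ)).prod (ContinuousLinearMap.snd ℝ ℝ (ι → ℝ))))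
      ((0 : ℝ), v) :=
    (S.Bc.isBoundedBilinearMap.hasStrictFDerivAt (v, v)).comp ((0 : ℝ), v) (h2.prodMk h2)
  have hK : HasStrictFDerivAt (fun p : ℝ × (ι → ℝ) => S.Kop p.2)
      (S.Kop.comp (ContinuousLinearMap.snd ℝ ℝ (ι → ℝ))) ((0 : ℝ), v) :=
    S.Kop.hasStrictFDerivAt.comp ((0 : ℝ), v) h2
  have hs : HasStrictFDerivAt (fun p : ℝ × (ι → ℝ) => p.1 • S.Kop p.2)
      ((0 : ℝ) • S.Kop.comp (ContinuousLinearMap.snd ℝ ℝ (ι → ℝ))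
        + (ContinuousLinearMap.fst ℝ ℝ (ι → ℝ)).smulRight (S.Kop v)) ((0 : ℝ), v) :=
    h1.smul hK
  exact h1.prodMk (hb.add hs)

/-- `Ĝ` is continuous. [folklore] -/
private theorem Psi_continuous_G : Continuous S.G := by
  have : S.G = fun x : ι → ℝ => ∑ m, S.K m * S.w m * x m ^ 2 := rfl
  rw [this]
  refine continuous_finsetSum _ fun m _ => ?_
  exact continuous_const.mul ((continuous_apply m).pow 2)

end GalerkinSystem

/-- **The barrier lemma holds** (sorry-free): a nondegenerate root of the truncated steady Euler
system continues to a branch of steady states with dissipation `O(r)` as `r → 0⁺` (inverse function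
theorem, `HasStrictFDerivAt.localInverse`). [cite: ChernyshenkoEtAl2014, §3b (p. 14: an unstable steady solution caps every bound over all invariant measures)] -/
theorem QuietRootFloorBarrier_holds : QuietRootFloorBarrier := by
  intro ι _ S hroot
  obtain ⟨v, hv, hbij⟩ := hroot
  -- the derivative of Ψ at (0,v) is a linear bijection
  have hinj : ∀ q : ℝ × (ι → ℝ), S.PsiDeriv v q = 0 → q = 0 := by
    rintro ⟨dr, dx⟩ hq
    rw [S.PsiDeriv_apply] at hq
    have hq1 : dr = 0 := by simpa using congrArg Prod.fst hq
    have hq2 : S.B v dx + S.B dx v + dr • S.Kop v = 0 := by simpa using congrArg Prod.snd hq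
    rw [hq1, zero_smul, add_zero] at hq2
    have hlin : S.linB v dx = 0 := by
      simpa [GalerkinSystem.linB, LinearMap.add_apply, LinearMap.flip_apply] using hq2
    have hdx : dx = 0 := (injective_iff_map_eq_zero (S.linB v)).1 hbij.1 dx hlin
    simp [hq1, hdx]
  have hker : LinearMap.ker (S.PsiDeriv v : (ℝ × (ι → ℝ)) →ₗ[ℝ] (ℝ × (ι → ℝ))) = ⊥ :=
    LinearMap.ker_eq_bot'.mpr hinj
  have hrange : LinearMap.range (S.PsiDeriv v : (ℝ × (ι → ℝ)) →ₗ[ℝ] (ℝ × (ι → ℝ))) = ⊤ := by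
    have hi : Function.Injective (S.PsiDeriv v : (ℝ × (ι → ℝ)) →ₗ[ℝ] (ℝ × (ι → ℝ))) :=
      LinearMap.ker_eq_bot.mp hker
    exact LinearMap.range_eq_top.mpr (LinearMap.injective_iff_surjective.mp hi)
  set e : (ℝ × (ι → ℝ)) ≃L[ℝ] (ℝ × (ι → ℝ)) :=
    ContinuousLinearEquiv.ofBijective (S.PsiDeriv v) hker hrange with he
  have hΨe : HasStrictFDerivAt S.Psi (e : (ℝ × (ι → ℝ)) →L[ℝ] (ℝ × (ι → ℝ))) ((0 : ℝ), v) := by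
    rw [he, ContinuousLinearEquiv.coe_ofBijective]
    exact S.hasStrictFDerivAt_Psi v
  -- the local inverse g of Ψ near Ψ(0,v) = (0,f)
  have hΨa : S.Psi ((0 : ℝ), v) = ((0 : ℝ), S.f) := by
    refine Prod.ext rfl ?_
    show S.Bc v v + (0 : ℝ) • S.Kop v = S.f
    rw [zero_smul, add_zero]
    funext m
    rw [S.Bc_apply, hv]
  set g := hΨe.localInverse S.Psi e ((0 : ℝ), v) with hg
  have hright : ∀ᶠ y in 𝓝 (S.Psi ((0 : ℝ), v)), S.Psi (g y) = y := hΨe.eventually_right_inverse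
  have htend : Tendsto g (𝓝 (S.Psi ((0 : ℝ), v))) (𝓝 ((0 : ℝ), v)) := hΨe.localInverse_tendsto
  -- restrict to the line y = (r, f)
  have hu : Tendsto (fun r : ℝ => ((r, S.f) : ℝ × (ι → ℝ))) (𝓝 0) (𝓝 (S.Psi ((0 : ℝ), v))) := by
    rw [hΨa]
    exact ((continuous_id.prodMk continuous_const).tendsto' 0 ((0 : ℝ), S.f) rfl)
  have hev1 : ∀ᶠ r : ℝ in 𝓝 0, S.Psi (g (r, S.f)) = (r, S.f) := hu.eventually hright
  have hev2 : ∀ᶠ r : ℝ in 𝓝 0, S.G (g (r, S.f)).2 < S.G v + 1 := by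
    have hg2 : Tendsto (fun r : ℝ => (g (r, S.f)).2) (𝓝 0) (𝓝 v) :=
      (continuous_snd.tendsto ((0 : ℝ), v)).comp (htend.comp hu)
    have hG : Tendsto (fun r : ℝ => S.G (g (r, S.f)).2) (𝓝 0) (𝓝 (S.G v)) :=
      ((S.Psi_continuous_G).tendsto v).comp hg2
    exact hG.eventually (eventually_lt_nhds (lt_add_one _))
  obtain ⟨ε, hε, hball⟩ := Metric.eventually_nhds_iff.mp (hev1.and hev2)
  refine ⟨S.G v + 1, ε, hε, fun r hr => ?_⟩
  have hrd : dist r 0 < ε := by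
    rw [Real.dist_eq, sub_zero, abs_of_pos hr.1]
    exact hr.2
  obtain ⟨hr1, hr2⟩ := hball hrd
  refine ⟨(g (r, S.f)).2, ?_, ?_⟩
  · -- steadiness: unpack Ψ (g (r,f)) = (r,f)
    have hfst : (g (r, S.f)).1 = r := congrArg Prod.fst hr1
    have hsnd : S.Bc (g (r, S.f)).2 (g (r, S.f)).2 + (g (r, S.f)).1 • S.Kop (g (r, S.f)).2 = S.f :=
      congrArg Prod.snd hr1
    rw [hfst] at hsnd
    show S.field r (g (r, S.f)).2 = 0
    funext m
    have hm := congrFun hsnd m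
    simp only [Pi.add_apply, Pi.smul_apply, smul_eq_mul, GalerkinSystem.Bc_apply,
      GalerkinSystem.Kop_apply] at hm
    simp only [GalerkinSystem.field, Pi.zero_apply]
    linarith
  · calc r * S.G (g (r, S.f)).2 = S.G (g (r, S.f)).2 * r := mul_comm _ _
      _ ≤ (S.G v + 1) * r := mul_le_mul_of_nonneg_right hr2.le hr.1.le

namespace GalerkinSystem

variable {ι : Type} [Fintype ι] (S : GalerkinSystem ι)

/-- **Unconditional form of the barrier**: a truncation with a nondegenerate root of
`B(v,v) = f` admits NO ν-uniform positive dissipation floor over its steady states.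
[cite: ChernyshenkoEtAl2014, §3b (p. 14: an unstable steady solution caps every bound over all invariant measures)] [cite: TobascoGoluskinDoering2018, Thm. 1] -/
theorem not_uniformFloor_of_nondegenerateRoot (h : S.HasNondegenerateRoot) : ¬ S.UniformFloor :=
  S.not_uniformFloor_of_root QuietRootFloorBarrier_holds h

end GalerkinSystem

end QuietRootFloor

end Literature.Barriers.AnomalousDissipation
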